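import Mathlib.Analysis.SpecialFunctions.Trigonometric.Deriv
import Mathlib.Analysis.InnerProductSpace.Calculus
import Mathlib.Analysis.Calculus.Deriv.Shift
import Mathlib.MeasureTheory.Integral.IntervalIntegral.Periodic
import Mathlib.MeasureTheory.Integral.IntervalIntegral.IntegrationByParts
import Mathlib.MeasureTheory.Integral.IntervalIntegral.FundThmCalculus
import Mathlib.MeasureTheory.Integral.CurveIntegral.Basic
import Mathlib.MeasureTheory.Integral.Prod
import Literature.Analysis.FluidPDE.Vorticity
import Literature.Analysis.FluidPDE.SelfSimilar
import HarnessLib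

/-!
# Circulation around closed loops: `C¹` loops, circles, invariances, and Stokes' theorem on
# planar discs

Topic `Literature/Analysis/FluidPDE`. The **circulation** `Γ = ∮_γ v · dℓ = ∫₀¹ ⟪v(γ(s)), γ′(s)⟫ ds`
of a vector field `v : E → E` around a curve `γ : ℝ → E` parametrised by `[0, 1]` is the tree's
`Literature.Analysis.FluidPDE.circulation` (`Vorticity.lean`; Majda–Bertozzi, *Vorticity and
Incompressible Flow*, §1.6, eq. (1.57)/(1.59), the quantity conserved by Kelvin's theorem,
discharged in `KelvinCirculationProofs.lean`). This file is the loop-side API of that notion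
(requested as `loopCirculation`; no second definition of the same integral is introduced):

* `IsC1Loop γ`: `γ` is `C¹` and `1`-periodic (a closed `C¹` loop read on `[0, 1]`);
  `Function.Periodic.deriv` (the derivative of a periodic map is periodic).
* `circleLoop c r e₁ e₂ s = c + (r cos 2πs) e₁ + (r sin 2πs) e₂`, the planar circle of "radius"
  `r` about `c` in the plane of the frame `(e₁, e₂)` (any two vectors), a `C¹` loop, and
  `circulation_circleLoop`: its circulation is the explicit angle integral
  `∫₀^{2π} ⟪v(c + (r cos θ) e₁ + (r sin θ) e₂), −(r sin θ) e₁ + (r cos θ) e₂⟫ dθ`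
  (the form used verbatim by route statements quantifying over planar circles in `ℝ³`).
* Linearity in the field (`circulation_add_left`, `circulation_sub_left`,
  `circulation_smul_left`, `circulation_neg_left`), vanishing for constant fields around loops
  (`circulation_const_left`).
* Invariances of the parametrisation: shift of the parameter of a periodic loop
  (`circulation_comp_add_const`), orientation reversal (`circulation_comp_const_sub`,
  `circulation_comp_one_sub`), and orientation-preserving reparametrisation
  (`circulation_comp_eq_of_deriv_nonneg`, monotone change of variables).
* Transformation rules: translation (`circulation_loop_add_const`), the Navier–Stokes scaling
  `circulation (nsRescaleData λ v) γ = circulation v (λ • γ)` (`circulation_nsRescaleData`: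
  circulation is scale invariant, it has the dimension of the viscosity), and linear isometries
  (`circulation_linearIsometryEquiv_comp`; for an equivariant field, `v ∘ g = g ∘ v`, the
  circulation around `g ∘ γ` equals that around `γ`, `circulation_comp_eq_of_equivariant`).
* The bridge to Mathlib's curve integral of the `1`-form `⟪v, ·⟫` along a `Path`
  (`curveIntegral_innerSL_eq_circulation`), which makes Mathlib's `curveIntegral_trans`
  (additivity under concatenation), `curveIntegral_symm`, `curveIntegral_segment` available.
* **Stokes' theorem for planar discs** (Green's formula in polar coordinates), for a `C¹` field on a
  general real inner product space: `circulation v (circleLoop c R e₁ e₂) =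
  ∫₀^R ∫₀^{2π} ρ (⟪Dv(x) e₁, e₂⟫ − ⟪Dv(x) e₂, e₁⟫) dθ dρ`, `x = c + (ρ cos θ) e₁ + (ρ sin θ) e₂`
  (`circulation_circleLoop_eq_integral_fderiv`), and on `ℝ³` the integrand is the normal vorticity
  `ρ ⟪curl v (x), e₁ × e₂⟫` (`inner_curl_cross`, `circulation_circleLoop_eq_integral_curl`):
  the circulation around a circle is the flux of the curl through the disc it bounds
  (Majda–Bertozzi, §1.6, (1.60)–(1.61); Saffman, *Vortex Dynamics*, §1.4).

## What is deliberately not here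

* No second name for the circulation: `loopCirculation v γ` of the request is literally
  `Literature.Analysis.FluidPDE.circulation v γ` (same integrand, same parametrisation `[0, 1]`,
  any real inner product space, in particular `ℝ³`).
* Kelvin's theorem *with viscosity* for material loops of classical Navier–Stokes solutions,
  `d/dt ∮_{C(t)} u · dℓ = ν ∮_{C(t)} Δu · dℓ = −ν ∮_{C(t)} curl ω · dℓ` (Majda–Bertozzi, (1.61)):
  the inviscid case is the discharged `IsClassicalEulerSolutionOn.circulation_eq`
  (`KelvinCirculationProofs.lean`); the viscous identity is left to a separate file.
* The disc flux as a set integral over the disc (polar change of variables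
  `MeasureTheory.integral_comp_polarCoord_symm`): only the polar form is given.

## Proof of the disc formula

With `F(ρ, θ) = ⟪v(x), ∂_θ x⟫` and `G(ρ, θ) = ⟪v(x), ∂_ρ x⟫` one has the exact identity
`∂_ρ F − ∂_θ G = ρ (⟪Dv(x) e₁, e₂⟫ − ⟪Dv(x) e₂, e₁⟫)` (the mixed second derivatives of `x(ρ, θ)`
cancel and `cos² + sin² = 1`); integrating over `[0, R] × [0, 2π]`, `∫₀^{2π} ∂_θ G dθ = 0` by
periodicity, Fubini for the continuous `∂_ρ F` and the fundamental theorem of calculus in `ρ`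
give `∫₀^{2π} F(R, θ) dθ − ∫₀^{2π} F(0, θ) dθ = ∫₀^{2π} F(R, θ) dθ`, the circulation.
No orthonormality of `(e₁, e₂)` and no sign condition on `R` are needed.

## Mathlib / tree search

Tree: `circulation`, `circulation_zero_left` (`Vorticity.lean`), Kelvin's theorem
(`KelvinCirculationProofs.lean`), polygon circulations (`PolygonCirculation.lean`), `curl`, `cross`
(`VectorCalculus.lean`), `nsRescaleData` (`SelfSimilar.lean`). Mathlib: `curveIntegral`
(`Mathlib.MeasureTheory.Integral.CurveIntegral.Basic`), `Function.Periodic.intervalIntegral_add_eq`,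
`intervalIntegral.integral_comp_mul_deriv_of_deriv_nonneg`, `MeasureTheory.integral_integral_swap`;
Mathlib has no `Function.Periodic.deriv`, no circulation and no Green/Stokes theorem on discs at
this pin (searched `circulation`, `lineIntegral`, `Green`, `Stokes`: divergence theorem on boxes only).

## References

* A. J. Majda, A. L. Bertozzi, *Vorticity and Incompressible Flow* (CUP 2002), §1.6,
  eqs. (1.57)–(1.61), Prop. 1.11. [MajdaBertozziCUP2002]
* P. G. Saffman, *Vortex Dynamics* (CUP 1992), §1.4–1.5 (circulation, Kelvin's theorem).
-/

noncomputable section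

open MeasureTheory Set Function Filter intervalIntegral Real
open _root_.Topology
open scoped InnerProductSpace RealInnerProductSpace

namespace Literature.Analysis.FluidPDE

/-! ### Periodic maps and `C¹` loops -/

/-- The derivative of a `c`-periodic map `ℝ → F` is `c`-periodic (no differentiability needed:
`deriv` commutes with translations, junk values included). [folklore] -/
theorem _root_.Function.Periodic.deriv {F : Type*} [NormedAddCommGroup F] [NormedSpace ℝ F]
    {γ : ℝ → F} {c : ℝ} (h : Periodic γ c) : Periodic (deriv γ) c := by
  intro s
  have hfun : (fun x => γ (x + c)) = γ := funext h
  rw [← deriv_comp_add_const γ c s, hfun]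

section LoopsBasic

variable {E : Type*} [NormedAddCommGroup E] [NormedSpace ℝ E]

/-- A **closed `C¹` loop** read on the parameter interval `[0, 1]`: `γ : ℝ → E` is continuously
differentiable and `1`-periodic (so `γ 0 = γ 1` and `γ′ 0 = γ′ 1`), the class of curves in Kelvin's
circulation theorem (Majda–Bertozzi, §1.6, Prop. 1.11: "a smooth closed curve"). [folklore] -/
structure IsC1Loop (γ : ℝ → E) : Prop where
  /-- The loop is continuously differentiable. -/
  contDiff : ContDiff ℝ 1 γ
  /-- The loop is `1`-periodic. -/
  periodic : Periodic γ 1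

/-- Unfolding `IsC1Loop`. [folklore] -/
theorem isC1Loop_iff (γ : ℝ → E) :
    IsC1Loop γ ↔ ContDiff ℝ 1 γ ∧ Periodic γ 1 :=
  ⟨fun h => ⟨h.contDiff, h.periodic⟩, fun h => ⟨h.1, h.2⟩⟩

namespace IsC1Loop

variable {γ : ℝ → E}

/-- A `C¹` loop is continuous. [folklore] -/
theorem continuous (h : IsC1Loop γ) : Continuous γ := h.contDiff.continuous

/-- A `C¹` loop is differentiable. [folklore] -/
theorem differentiable (h : IsC1Loop γ) : Differentiable ℝ γ :=
  h.contDiff.differentiable one_ne_zero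

/-- The velocity of a `C¹` loop is continuous. [folklore] -/
theorem continuous_deriv (h : IsC1Loop γ) : Continuous (deriv γ) :=
  h.contDiff.continuous_deriv le_rfl

/-- The velocity of a `C¹` loop is `1`-periodic. [folklore] -/
theorem periodic_deriv (h : IsC1Loop γ) : Periodic (deriv γ) 1 := h.periodic.deriv

/-- A `C¹` loop closes up: `γ 0 = γ 1`. [folklore] -/
theorem apply_zero_eq_apply_one (h : IsC1Loop γ) : γ 0 = γ 1 := by
  simpa using (h.periodic 0).symm

/-- Translating a `C¹` loop gives a `C¹` loop. [folklore] -/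
theorem add_const (h : IsC1Loop γ) (a : E) : IsC1Loop fun s => γ s + a :=
  ⟨h.contDiff.add contDiff_const, fun s => by simp [h.periodic s]⟩

/-- Rescaling a `C¹` loop gives a `C¹` loop. [folklore] -/
theorem const_smul (h : IsC1Loop γ) (c : ℝ) : IsC1Loop (c • γ) :=
  ⟨contDiff_const.smul h.contDiff, fun s => by simp [h.periodic s]⟩

/-- Shifting the parameter of a `C¹` loop gives a `C¹` loop. [folklore] -/
theorem comp_add_const (h : IsC1Loop γ) (a : ℝ) : IsC1Loop fun s => γ (s + a) :=
  ⟨h.contDiff.comp (contDiff_id.add contDiff_const), fun s => by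
    show γ (s + 1 + a) = γ (s + a)
    rw [add_right_comm, h.periodic]⟩

/-- The image of a `C¹` loop under a continuous linear map is a `C¹` loop. [folklore] -/
theorem clm_comp {F : Type*} [NormedAddCommGroup F] [NormedSpace ℝ F] (h : IsC1Loop γ)
    (L : E →L[ℝ] F) : IsC1Loop (L ∘ γ) :=
  ⟨L.contDiff.comp h.contDiff, h.periodic.comp L⟩

end IsC1Loop

end LoopsBasic

section Loops

variable {E : Type*} [NormedAddCommGroup E] [InnerProductSpace ℝ E]

/-! ### Integrability of the circulation integrand -/

/-- For a continuous field and a `C¹` curve the circulation integrand `⟪v(γ s), γ′ s⟫` is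
continuous, hence interval integrable on every interval. [folklore] -/
theorem intervalIntegrable_inner_deriv {v : E → E} {γ : ℝ → E} (hv : Continuous v)
    (hγ : ContDiff ℝ 1 γ) (a b : ℝ) :
    IntervalIntegrable (fun s => ⟪v (γ s), deriv γ s⟫) volume a b :=
  (((hv.comp hγ.continuous).inner (hγ.continuous_deriv le_rfl)).intervalIntegrable a b)

/-! ### Linearity in the field -/

/-- Additivity of the circulation in the field, under interval integrability of both integrands. [folklore] -/
theorem circulation_add_left_of_integrable {v w : E → E} {γ : ℝ → E}
    (hv : IntervalIntegrable (fun s => ⟪v (γ s), deriv γ s⟫) volume 0 1)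
    (hw : IntervalIntegrable (fun s => ⟪w (γ s), deriv γ s⟫) volume 0 1) :
    circulation (v + w) γ = circulation v γ + circulation w γ := by
  unfold circulation
  rw [← integral_add hv hw]
  exact integral_congr fun s _ => by simp [inner_add_left]

/-- Additivity of the circulation in the field, for continuous fields around a `C¹` curve. [folklore] -/
theorem circulation_add_left {v w : E → E} {γ : ℝ → E} (hv : Continuous v) (hw : Continuous w)
    (hγ : ContDiff ℝ 1 γ) :
    circulation (v + w) γ = circulation v γ + circulation w γ :=
  circulation_add_left_of_integrable (intervalIntegrable_inner_deriv hv hγ 0 1)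
    (intervalIntegrable_inner_deriv hw hγ 0 1)

/-- Homogeneity of the circulation in the field (unconditional). [folklore] -/
theorem circulation_smul_left (c : ℝ) (v : E → E) (γ : ℝ → E) :
    circulation (c • v) γ = c * circulation v γ := by
  unfold circulation
  rw [← intervalIntegral.integral_const_mul]
  exact integral_congr fun s _ => by simp [real_inner_smul_left]

/-- The circulation is odd in the field (unconditional). [folklore] -/
theorem circulation_neg_left (v : E → E) (γ : ℝ → E) :
    circulation (-v) γ = -circulation v γ := by
  have h := circulation_smul_left (-1) v γ
  simp only [neg_smul, one_smul, neg_mul, one_mul] at h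
  exact h

/-- Subtractivity of the circulation in the field, for continuous fields around a `C¹` curve. [folklore] -/
theorem circulation_sub_left {v w : E → E} {γ : ℝ → E} (hv : Continuous v) (hw : Continuous w)
    (hγ : ContDiff ℝ 1 γ) :
    circulation (v - w) γ = circulation v γ - circulation w γ := by
  rw [sub_eq_add_neg, circulation_add_left hv hw.neg hγ, circulation_neg_left, sub_eq_add_neg]

/-- A constant field has zero circulation around a closed `C¹` curve:
`∫₀¹ ⟪a, γ′⟫ = ⟪a, γ 1 − γ 0⟫ = 0`. [folklore] -/
theorem circulation_const_left {γ : ℝ → E} (hγ : ContDiff ℝ 1 γ) (hloop : γ 0 = γ 1) (a : E) :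
    circulation (fun _ => a) γ = 0 := by
  unfold circulation
  have hderiv : ∀ s ∈ uIcc (0 : ℝ) 1, HasDerivAt (fun s => ⟪a, γ s⟫) ⟪a, deriv γ s⟫ s := by
    intro s _
    simpa using (hasDerivAt_const s a).inner ℝ (hγ.differentiable one_ne_zero s).hasDerivAt
  rw [integral_eq_sub_of_hasDerivAt hderiv
    (intervalIntegrable_inner_deriv continuous_const hγ 0 1), hloop, sub_self]

/-! ### Invariance under reparametrisation -/

/-- **Shift invariance.** For a `1`-periodic curve the circulation does not depend on the base
point of the parametrisation: `∮ v · dℓ` over `s ↦ γ (s + a)` equals that over `γ`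
(the integrand is `1`-periodic and `∫ₐ^{a+1} = ∫₀¹`). [folklore] -/
theorem circulation_comp_add_const (v : E → E) {γ : ℝ → E} (hγ : Periodic γ 1) (a : ℝ) :
    circulation v (fun s => γ (s + a)) = circulation v γ := by
  unfold circulation
  have hper : Periodic (fun s => ⟪v (γ s), deriv γ s⟫) 1 := fun s => by
    simp only [hγ s, hγ.deriv s]
  have h1 := intervalIntegral.integral_comp_add_right (a := 0) (b := 1)
    (fun s => ⟪v (γ s), deriv γ s⟫) a
  simp only [zero_add] at h1
  simp only [deriv_comp_add_const]
  rw [h1, add_comm, hper.intervalIntegral_add_eq a 0, zero_add]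

/-- **Orientation reversal** on `[0, 1]`: `∮` over `s ↦ γ (1 − s)` is `−∮` over `γ`. [folklore] -/
theorem circulation_comp_one_sub (v : E → E) (γ : ℝ → E) :
    circulation v (fun s => γ (1 - s)) = -circulation v γ := by
  unfold circulation
  have h2 := intervalIntegral.integral_comp_sub_left (a := 0) (b := 1)
    (fun s => ⟪v (γ s), deriv γ s⟫) 1
  simp only [sub_self, sub_zero] at h2
  simp only [deriv_comp_const_sub, inner_neg_right]
  rw [intervalIntegral.integral_neg, h2]

/-- **Orientation reversal** for a `1`-periodic curve, about any base point `a`: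
`∮` over `s ↦ γ (a − s)` is `−∮` over `γ`. [folklore] -/
theorem circulation_comp_const_sub (v : E → E) {γ : ℝ → E} (hγ : Periodic γ 1) (a : ℝ) :
    circulation v (fun s => γ (a - s)) = -circulation v γ := by
  have h1 : (fun s => γ (a - s)) = fun s => (fun t => γ (1 - t)) (s + (1 - a)) := by
    funext s
    show γ (a - s) = γ (1 - (s + (1 - a)))
    congr 1
    ring
  rw [h1, circulation_comp_add_const v (γ := fun t => γ (1 - t)) ?_ (1 - a),
    circulation_comp_one_sub]
  intro s
  show γ (1 - (s + 1)) = γ (1 - s)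
  rw [show 1 - (s + 1) = (1 - s) - 1 by ring, hγ.sub_eq]

/-- **Reparametrisation invariance.** If `φ` is continuous on `[0, 1]` with `φ 0 = 0`, `φ 1 = 1`,
differentiable with derivative `φ′ ≥ 0` on `(0, 1)`, and `γ` is differentiable, then the
circulation around `γ ∘ φ` equals that around `γ` (chain rule and the change of variables
`u = φ s` for monotone maps, `intervalIntegral.integral_comp_mul_deriv_of_deriv_nonneg`). [folklore] -/
theorem circulation_comp_eq_of_deriv_nonneg (v : E → E) {γ : ℝ → E} (hγ : Differentiable ℝ γ)
    {φ φ' : ℝ → ℝ} (hφ : ContinuousOn φ (Icc 0 1))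
    (hφ' : ∀ s ∈ Ioo (0 : ℝ) 1, HasDerivAt φ (φ' s) s) (hpos : ∀ s ∈ Ioo (0 : ℝ) 1, 0 ≤ φ' s)
    (h0 : φ 0 = 0) (h1 : φ 1 = 1) :
    circulation v (γ ∘ φ) = circulation v γ := by
  unfold circulation
  set g : ℝ → ℝ := fun u => ⟪v (γ u), deriv γ u⟫ with hg
  have hae : EqOn (fun s => ⟪v ((γ ∘ φ) s), deriv (γ ∘ φ) s⟫) (fun s => (g ∘ φ) s * φ' s)
      (Ioo 0 1) := by
    intro s hs
    have hd : HasDerivAt (γ ∘ φ) (φ' s • deriv γ (φ s)) s :=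
      (hγ (φ s)).hasDerivAt.scomp s (hφ' s hs)
    simp only [hd.deriv, comp_apply, hg, real_inner_smul_right]
    ring
  rw [integral_congr_Ioo_of_le zero_le_one hae]
  have hI : Ioo (min (0 : ℝ) 1) (max 0 1) = Ioo 0 1 := by
    rw [min_eq_left zero_le_one, max_eq_right zero_le_one]
  have h := integral_comp_mul_deriv_of_deriv_nonneg (a := 0) (b := 1) (g := g)
    (by rwa [uIcc_of_le zero_le_one]) (fun x hx => hφ' x (hI ▸ hx)) (fun x hx => hpos x (hI ▸ hx))
  rw [h, h0, h1]

/-! ### Transformation rules: translations, scalings, isometries -/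

/-- **Translation**: the circulation of `v` around the translated curve `γ + a` is the
circulation of the translated field `x ↦ v (x + a)` around `γ`. [folklore] -/
theorem circulation_loop_add_const (v : E → E) (γ : ℝ → E) (a : E) :
    circulation v (fun s => γ s + a) = circulation (fun x => v (x + a)) γ := by
  unfold circulation
  simp_rw [deriv_add_const]

/-- **Scaling**: the circulation of `v` around the dilated curve `c • γ` is the circulation of
the Navier–Stokes rescaled field `nsRescaleData c v = c • v (c •)` around `γ`; in particular the
circulation is invariant under the Navier–Stokes scaling (it has the dimension of the kinematic
viscosity). Unconditional (`deriv (c • γ) = c • deriv γ` with junk values). [folklore] -/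
theorem circulation_nsRescaleData (c : ℝ) (v : E → E) (γ : ℝ → E) :
    circulation (nsRescaleData c v) γ = circulation v (c • γ) := by
  unfold circulation nsRescaleData
  refine integral_congr fun s _ => ?_
  simp only [Pi.smul_apply, deriv_const_smul_field, real_inner_smul_left, real_inner_smul_right]

/-- The same scaling rule with the dilation written as a function. [folklore] -/
theorem circulation_smul_loop (c : ℝ) (v : E → E) (γ : ℝ → E) :
    circulation v (fun s => c • γ s) = circulation (fun x => c • v (c • x)) γ :=
  (circulation_nsRescaleData c v γ).symm

/-- **Linear isometries**: for `g : E ≃ₗᵢ[ℝ] F`, the circulation of `v` around `g ∘ γ` is the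
circulation of the conjugated field `g⁻¹ ∘ v ∘ g` around `γ` (`(g ∘ γ)′ = g γ′` and
`⟪v, g w⟫ = ⟪g⁻¹ v, w⟫`). Unconditional. [folklore] -/
theorem circulation_linearIsometryEquiv_comp {F : Type*} [NormedAddCommGroup F]
    [InnerProductSpace ℝ F] (g : E ≃ₗᵢ[ℝ] F) (v : F → F) (γ : ℝ → E) :
    circulation v (g ∘ γ) = circulation (g.symm ∘ v ∘ g) γ := by
  unfold circulation
  refine integral_congr fun s _ => ?_
  have hderiv : deriv (g ∘ γ) s = g (deriv γ s) := by
    by_cases hd : DifferentiableAt ℝ γ s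
    · exact (g.toContinuousLinearEquiv.toContinuousLinearMap.hasFDerivAt.comp_hasDerivAt s
        hd.hasDerivAt).deriv
    · rw [deriv_zero_of_not_differentiableAt hd, map_zero, deriv_zero_of_not_differentiableAt]
      exact fun h => hd (g.toContinuousLinearEquiv.comp_differentiableAt_iff.1 h)
  simp only [comp_apply, hderiv]
  conv_lhs => rw [← g.apply_symm_apply (v (g (γ s)))]
  exact g.inner_map_map _ _

/-- **Equivariant fields**: if `v ∘ g = g ∘ v` for a linear isometry `g` of `E` (e.g. a field with
a point-group symmetry), the circulation of `v` around `g ∘ γ` equals that around `γ`. [folklore] -/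
theorem circulation_comp_eq_of_equivariant (g : E ≃ₗᵢ[ℝ] E) {v : E → E}
    (hv : ∀ x, v (g x) = g (v x)) (γ : ℝ → E) :
    circulation v (g ∘ γ) = circulation v γ := by
  rw [circulation_linearIsometryEquiv_comp]
  congr 1
  funext x
  simp [hv]

/-! ### Bridge to Mathlib's curve integral -/

/-- The circulation of `v` around (the extension to `ℝ` of) a Mathlib `Path` is Mathlib's curve
integral of the `1`-form `x ↦ ⟪v x, ·⟫` along it; this makes `curveIntegral_trans` (additivity
under concatenation of paths), `curveIntegral_symm` and `curveIntegral_segment` available for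
circulations. [folklore] -/
theorem curveIntegral_innerSL_eq_circulation {a b : E} (v : E → E)
    (γ : Path a b) : (∫ᶜ x in γ, innerSL ℝ (v x)) = circulation v γ.extend := by
  rw [curveIntegral_eq_intervalIntegral_deriv]
  rfl

/-! ### Planar circles -/

/-- The **planar circle** `s ↦ c + (r cos 2πs) e₁ + (r sin 2πs) e₂` about `c`, of "radius" `r`,
in the plane of the frame `(e₁, e₂)` (a genuine circle of radius `|r|` when `(e₁, e₂)` is
orthonormal), parametrised `1`-periodically. [folklore] -/
def circleLoop (c : E) (r : ℝ) (e₁ e₂ : E) : ℝ → E := fun s =>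
  c + (r * cos (2 * π * s)) • e₁ + (r * sin (2 * π * s)) • e₂

/-- Unfolding `circleLoop`. [folklore] -/
theorem circleLoop_apply (c : E) (r : ℝ) (e₁ e₂ : E) (s : ℝ) :
    circleLoop c r e₁ e₂ s = c + (r * cos (2 * π * s)) • e₁ + (r * sin (2 * π * s)) • e₂ :=
  rfl

/-- The circle of radius `0` is the constant loop at its centre. [folklore] -/
@[simp]
theorem circleLoop_zero_radius (c e₁ e₂ : E) : circleLoop c 0 e₁ e₂ = fun _ => c := by
  funext s
  simp [circleLoop]

/-- The velocity of the planar circle: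
`d/ds circleLoop s = 2π (−(r sin 2πs) e₁ + (r cos 2πs) e₂)`. [folklore] -/
theorem hasDerivAt_circleLoop (c : E) (r : ℝ) (e₁ e₂ : E) (s : ℝ) :
    HasDerivAt (circleLoop c r e₁ e₂)
      ((2 * π) • ((-(r * sin (2 * π * s))) • e₁ + (r * cos (2 * π * s)) • e₂)) s := by
  have hθ : HasDerivAt (fun s : ℝ => 2 * π * s) (2 * π) s := by
    simpa using (hasDerivAt_id s).const_mul (2 * π)
  have hcos : HasDerivAt (fun s : ℝ => r * cos (2 * π * s)) (r * (-sin (2 * π * s) * (2 * π))) s :=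
    ((hasDerivAt_cos _).comp s hθ).const_mul r
  have hsin : HasDerivAt (fun s : ℝ => r * sin (2 * π * s)) (r * (cos (2 * π * s) * (2 * π))) s :=
    ((hasDerivAt_sin _).comp s hθ).const_mul r
  have h : HasDerivAt (circleLoop c r e₁ e₂)
      ((r * (-sin (2 * π * s) * (2 * π))) • e₁ + (r * (cos (2 * π * s) * (2 * π))) • e₂) s :=
    ((hcos.smul_const e₁).const_add c).fun_add (hsin.smul_const e₂)
  refine h.congr_deriv ?_
  rw [smul_add, smul_smul, smul_smul]
  congr 2 <;> ring

/-- The velocity of the planar circle, `deriv` form. [folklore] -/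
theorem deriv_circleLoop (c : E) (r : ℝ) (e₁ e₂ : E) (s : ℝ) :
    deriv (circleLoop c r e₁ e₂) s =
      (2 * π) • ((-(r * sin (2 * π * s))) • e₁ + (r * cos (2 * π * s)) • e₂) :=
  (hasDerivAt_circleLoop c r e₁ e₂ s).deriv

/-- The planar circle is smooth. [folklore] -/
theorem contDiff_circleLoop (c : E) (r : ℝ) (e₁ e₂ : E) {n : WithTop ℕ∞} :
    ContDiff ℝ n (circleLoop c r e₁ e₂) := by
  unfold circleLoop
  fun_prop

/-- The planar circle is `1`-periodic. [folklore] -/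
theorem periodic_circleLoop (c : E) (r : ℝ) (e₁ e₂ : E) : Periodic (circleLoop c r e₁ e₂) 1 := by
  intro s
  simp only [circleLoop, mul_add, mul_one]
  rw [cos_add_two_pi, sin_add_two_pi]

/-- The planar circle is a closed `C¹` loop. [folklore] -/
theorem isC1Loop_circleLoop (c : E) (r : ℝ) (e₁ e₂ : E) : IsC1Loop (circleLoop c r e₁ e₂) :=
  ⟨contDiff_circleLoop c r e₁ e₂, periodic_circleLoop c r e₁ e₂⟩

/-- **Circulation around a planar circle as an angle integral**:
`∮_{circleLoop c r e₁ e₂} v · dℓ = ∫₀^{2π} ⟪v(c + (r cos θ) e₁ + (r sin θ) e₂), −(r sin θ) e₁ + (r cos θ) e₂⟫ dθ`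
(substitution `θ = 2πs`). Unconditional in `v`. [folklore] -/
theorem circulation_circleLoop (v : E → E) (c : E) (r : ℝ) (e₁ e₂ : E) :
    circulation v (circleLoop c r e₁ e₂) = ∫ θ in (0 : ℝ)..2 * π,
      ⟪v (c + (r * cos θ) • e₁ + (r * sin θ) • e₂), (-(r * sin θ)) • e₁ + (r * cos θ) • e₂⟫ := by
  unfold circulation
  set g : ℝ → ℝ := fun θ =>
    ⟪v (c + (r * cos θ) • e₁ + (r * sin θ) • e₂), (-(r * sin θ)) • e₁ + (r * cos θ) • e₂⟫ with hg
  have hint : ∀ s : ℝ, ⟪v (circleLoop c r e₁ e₂ s), deriv (circleLoop c r e₁ e₂) s⟫ =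
      (2 * π) * g (2 * π * s) := by
    intro s
    simp only [deriv_circleLoop, real_inner_smul_right, hg, circleLoop_apply]
  have h2 := intervalIntegral.smul_integral_comp_mul_left (a := 0) (b := 1) g (2 * π)
  rw [smul_eq_mul, mul_zero, mul_one] at h2
  simp_rw [hint]
  rw [intervalIntegral.integral_const_mul, h2]

end Loops

/-! ### Stokes' theorem on planar discs (Green's formula in polar coordinates) -/

section Disc

variable {E : Type*} [NormedAddCommGroup E] [InnerProductSpace ℝ E]

/-- **Affine polar coordinates** of the plane through `c` spanned by the frame `(e₁, e₂)`:
`planePolar c e₁ e₂ ρ θ = c + (ρ cos θ) e₁ + (ρ sin θ) e₂`, so that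
`circleLoop c r e₁ e₂ s = planePolar c e₁ e₂ r (2πs)`. [folklore] -/
def planePolar (c e₁ e₂ : E) (ρ θ : ℝ) : E := c + (ρ * cos θ) • e₁ + (ρ * sin θ) • e₂

/-- Unfolding `planePolar`. [folklore] -/
theorem planePolar_apply (c e₁ e₂ : E) (ρ θ : ℝ) :
    planePolar c e₁ e₂ ρ θ = c + (ρ * cos θ) • e₁ + (ρ * sin θ) • e₂ :=
  rfl

/-- At radius `0` the polar map sits at the centre. [folklore] -/
@[simp]
theorem planePolar_zero_radius (c e₁ e₂ : E) (θ : ℝ) : planePolar c e₁ e₂ 0 θ = c := by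
  simp [planePolar]

/-- The polar map is `2π`-periodic in the angle. [folklore] -/
theorem planePolar_add_two_pi (c e₁ e₂ : E) (ρ θ : ℝ) :
    planePolar c e₁ e₂ ρ (θ + 2 * π) = planePolar c e₁ e₂ ρ θ := by
  simp [planePolar]

/-- The planar circle in polar form: `circleLoop c r e₁ e₂ s = planePolar c e₁ e₂ r (2πs)`. [folklore] -/
theorem circleLoop_eq_planePolar (c : E) (r : ℝ) (e₁ e₂ : E) (s : ℝ) :
    circleLoop c r e₁ e₂ s = planePolar c e₁ e₂ r (2 * π * s) :=
  rfl

/-- The polar map is jointly continuous in `(ρ, θ)`. [folklore] -/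
theorem continuous_planePolar (c e₁ e₂ : E) :
    Continuous fun q : ℝ × ℝ => planePolar c e₁ e₂ q.1 q.2 := by
  unfold planePolar
  fun_prop

/-- Radial derivative of the polar map: `∂_ρ x = (cos θ) e₁ + (sin θ) e₂`. [folklore] -/
theorem hasDerivAt_planePolar_radius (c e₁ e₂ : E) (ρ θ : ℝ) :
    HasDerivAt (fun ρ => planePolar c e₁ e₂ ρ θ) ((cos θ) • e₁ + (sin θ) • e₂) ρ := by
  have h1 : HasDerivAt (fun ρ : ℝ => ρ * cos θ) (cos θ) ρ := hasDerivAt_mul_const (cos θ)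
  have h2 : HasDerivAt (fun ρ : ℝ => ρ * sin θ) (sin θ) ρ := hasDerivAt_mul_const (sin θ)
  exact ((h1.smul_const e₁).const_add c).fun_add (h2.smul_const e₂)

/-- Angular derivative of the polar map: `∂_θ x = −(ρ sin θ) e₁ + (ρ cos θ) e₂`. [folklore] -/
theorem hasDerivAt_planePolar_angle (c e₁ e₂ : E) (ρ θ : ℝ) :
    HasDerivAt (fun θ => planePolar c e₁ e₂ ρ θ) ((-(ρ * sin θ)) • e₁ + (ρ * cos θ) • e₂) θ := by
  have h1 : HasDerivAt (fun θ : ℝ => ρ * cos θ) (-(ρ * sin θ)) θ := by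
    simpa using (hasDerivAt_cos θ).const_mul ρ
  have h2 : HasDerivAt (fun θ : ℝ => ρ * sin θ) (ρ * cos θ) θ := (hasDerivAt_sin θ).const_mul ρ
  exact ((h1.smul_const e₁).const_add c).fun_add (h2.smul_const e₂)

/-- **The algebraic heart of Green's formula in polar coordinates.** For a linear map `D` and the
rotating frame `e_ρ = (cos θ) e₁ + (sin θ) e₂`, `e_θ = −(ρ sin θ) e₁ + (ρ cos θ) e₂`:
`⟪D e_ρ, e_θ⟫ − ⟪D e_θ, e_ρ⟫ = ρ (⟪D e₁, e₂⟫ − ⟪D e₂, e₁⟫)` (bilinearity, antisymmetry and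
`cos² θ + sin² θ = 1`; no orthonormality of `(e₁, e₂)` is used). [folklore] -/
theorem inner_apply_polar_frame_sub (D : E →L[ℝ] E) (ρ θ : ℝ) (e₁ e₂ : E) :
    ⟪D ((cos θ) • e₁ + (sin θ) • e₂), (-(ρ * sin θ)) • e₁ + (ρ * cos θ) • e₂⟫
      - ⟪D ((-(ρ * sin θ)) • e₁ + (ρ * cos θ) • e₂), (cos θ) • e₁ + (sin θ) • e₂⟫
      = ρ * (⟪D e₁, e₂⟫ - ⟪D e₂, e₁⟫) := by
  simp only [map_add, map_smul, inner_add_left, inner_add_right, real_inner_smul_left,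
    real_inner_smul_right]
  linear_combination (ρ * (⟪D e₁, e₂⟫ - ⟪D e₂, e₁⟫)) * cos_sq_add_sin_sq θ

variable {v : E → E}

/-- Radial derivative of the circulation density `F(ρ, θ) = ⟪v(x), ∂_θ x⟫`,
`x = planePolar c e₁ e₂ ρ θ`: `∂_ρ F = ⟪v(x), −(sin θ) e₁ + (cos θ) e₂⟫ + ⟪Dv(x) ∂_ρ x, ∂_θ x⟫`
(product and chain rules). [folklore] -/
theorem hasDerivAt_inner_planePolar_radius (hv : Differentiable ℝ v) (c e₁ e₂ : E) (ρ θ : ℝ) :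
    HasDerivAt (fun ρ => ⟪v (planePolar c e₁ e₂ ρ θ), (-(ρ * sin θ)) • e₁ + (ρ * cos θ) • e₂⟫)
      (⟪v (planePolar c e₁ e₂ ρ θ), (-(sin θ)) • e₁ + (cos θ) • e₂⟫
        + ⟪fderiv ℝ v (planePolar c e₁ e₂ ρ θ) ((cos θ) • e₁ + (sin θ) • e₂),
            (-(ρ * sin θ)) • e₁ + (ρ * cos θ) • e₂⟫) ρ := by
  have hY := (hv (planePolar c e₁ e₂ ρ θ)).hasFDerivAt.comp_hasDerivAt ρ
    (hasDerivAt_planePolar_radius c e₁ e₂ ρ θ)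
  have h1 : HasDerivAt (fun ρ : ℝ => -(ρ * sin θ)) (-(sin θ)) ρ := (hasDerivAt_mul_const (sin θ)).fun_neg
  have h2 : HasDerivAt (fun ρ : ℝ => ρ * cos θ) (cos θ) ρ := hasDerivAt_mul_const (cos θ)
  have hW : HasDerivAt (fun ρ : ℝ => (-(ρ * sin θ)) • e₁ + (ρ * cos θ) • e₂)
      ((-(sin θ)) • e₁ + (cos θ) • e₂) ρ := (h1.smul_const e₁).fun_add (h2.smul_const e₂)
  exact hY.inner ℝ hW

/-- Angular derivative of the radial density `G(ρ, θ) = ⟪v(x), ∂_ρ x⟫`,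
`x = planePolar c e₁ e₂ ρ θ`: `∂_θ G = ⟪v(x), −(sin θ) e₁ + (cos θ) e₂⟫ + ⟪Dv(x) ∂_θ x, ∂_ρ x⟫`. [folklore] -/
theorem hasDerivAt_inner_planePolar_angle (hv : Differentiable ℝ v) (c e₁ e₂ : E) (ρ θ : ℝ) :
    HasDerivAt (fun θ => ⟪v (planePolar c e₁ e₂ ρ θ), (cos θ) • e₁ + (sin θ) • e₂⟫)
      (⟪v (planePolar c e₁ e₂ ρ θ), (-(sin θ)) • e₁ + (cos θ) • e₂⟫
        + ⟪fderiv ℝ v (planePolar c e₁ e₂ ρ θ) ((-(ρ * sin θ)) • e₁ + (ρ * cos θ) • e₂),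
            (cos θ) • e₁ + (sin θ) • e₂⟫) θ := by
  have hY := (hv (planePolar c e₁ e₂ ρ θ)).hasFDerivAt.comp_hasDerivAt θ
    (hasDerivAt_planePolar_angle c e₁ e₂ ρ θ)
  have hW : HasDerivAt (fun θ : ℝ => (cos θ) • e₁ + (sin θ) • e₂)
      ((-(sin θ)) • e₁ + (cos θ) • e₂) θ :=
    ((hasDerivAt_cos θ).smul_const e₁).fun_add ((hasDerivAt_sin θ).smul_const e₂)
  exact hY.inner ℝ hW

/-- Joint continuity of the radial derivative `∂_ρ F` of the circulation density for a `C¹`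
field. [folklore] -/
theorem continuous_inner_planePolar_radius_deriv (hv : ContDiff ℝ 1 v) (c e₁ e₂ : E) :
    Continuous fun q : ℝ × ℝ =>
      ⟪v (planePolar c e₁ e₂ q.1 q.2), (-(sin q.2)) • e₁ + (cos q.2) • e₂⟫
        + ⟪fderiv ℝ v (planePolar c e₁ e₂ q.1 q.2) ((cos q.2) • e₁ + (sin q.2) • e₂),
            (-(q.1 * sin q.2)) • e₁ + (q.1 * cos q.2) • e₂⟫ := by
  have hP := continuous_planePolar c e₁ e₂
  have hvP : Continuous fun q : ℝ × ℝ => v (planePolar c e₁ e₂ q.1 q.2) := hv.continuous.comp hP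
  have hDP : Continuous fun q : ℝ × ℝ => fderiv ℝ v (planePolar c e₁ e₂ q.1 q.2) :=
    (hv.continuous_fderiv one_ne_zero).comp hP
  exact (hvP.inner (by fun_prop)).add ((hDP.clm_apply (by fun_prop)).inner (by fun_prop))

/-- Continuity in the angle of `∂_θ G` for a `C¹` field. [folklore] -/
theorem continuous_inner_planePolar_angle_deriv (hv : ContDiff ℝ 1 v) (c e₁ e₂ : E) (ρ : ℝ) :
    Continuous fun θ : ℝ =>
      ⟪v (planePolar c e₁ e₂ ρ θ), (-(sin θ)) • e₁ + (cos θ) • e₂⟫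
        + ⟪fderiv ℝ v (planePolar c e₁ e₂ ρ θ) ((-(ρ * sin θ)) • e₁ + (ρ * cos θ) • e₂),
            (cos θ) • e₁ + (sin θ) • e₂⟫ := by
  have hP : Continuous fun θ : ℝ => planePolar c e₁ e₂ ρ θ := by unfold planePolar; fun_prop
  have hvP : Continuous fun θ : ℝ => v (planePolar c e₁ e₂ ρ θ) := hv.continuous.comp hP
  have hDP : Continuous fun θ : ℝ => fderiv ℝ v (planePolar c e₁ e₂ ρ θ) :=
    (hv.continuous_fderiv one_ne_zero).comp hP
  exact (hvP.inner (by fun_prop)).add ((hDP.clm_apply (by fun_prop)).inner (by fun_prop))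

/-- Over a full turn the angular derivative `∂_θ G` integrates to zero (periodicity of
`G(ρ, ·)`, fundamental theorem of calculus). [folklore] -/
theorem integral_inner_planePolar_angle_deriv_eq_zero (hv : ContDiff ℝ 1 v) (c e₁ e₂ : E) (ρ : ℝ) :
    ∫ θ in (0 : ℝ)..2 * π,
      (⟪v (planePolar c e₁ e₂ ρ θ), (-(sin θ)) • e₁ + (cos θ) • e₂⟫
        + ⟪fderiv ℝ v (planePolar c e₁ e₂ ρ θ) ((-(ρ * sin θ)) • e₁ + (ρ * cos θ) • e₂),
            (cos θ) • e₁ + (sin θ) • e₂⟫) = 0 := by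
  rw [integral_eq_sub_of_hasDerivAt
    (fun θ _ => hasDerivAt_inner_planePolar_angle (hv.differentiable one_ne_zero) c e₁ e₂ ρ θ)
    ((continuous_inner_planePolar_angle_deriv hv c e₁ e₂ ρ).intervalIntegrable _ _)]
  simp [planePolar]

/-- In the radius, `∂_ρ F` integrates back to the circulation density:
`∫₀^R ∂_ρ F(ρ, θ) dρ = F(R, θ) − F(0, θ) = F(R, θ)` (`∂_θ x = 0` at `ρ = 0`). [folklore] -/
theorem integral_inner_planePolar_radius_deriv (hv : ContDiff ℝ 1 v) (c e₁ e₂ : E) (θ R : ℝ) :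
    ∫ ρ in (0 : ℝ)..R,
      (⟪v (planePolar c e₁ e₂ ρ θ), (-(sin θ)) • e₁ + (cos θ) • e₂⟫
        + ⟪fderiv ℝ v (planePolar c e₁ e₂ ρ θ) ((cos θ) • e₁ + (sin θ) • e₂),
            (-(ρ * sin θ)) • e₁ + (ρ * cos θ) • e₂⟫)
      = ⟪v (planePolar c e₁ e₂ R θ), (-(R * sin θ)) • e₁ + (R * cos θ) • e₂⟫ := by
  have hc : Continuous fun ρ : ℝ =>
      ⟪v (planePolar c e₁ e₂ ρ θ), (-(sin θ)) • e₁ + (cos θ) • e₂⟫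
        + ⟪fderiv ℝ v (planePolar c e₁ e₂ ρ θ) ((cos θ) • e₁ + (sin θ) • e₂),
            (-(ρ * sin θ)) • e₁ + (ρ * cos θ) • e₂⟫ :=
    (continuous_inner_planePolar_radius_deriv hv c e₁ e₂).comp
      (continuous_id.prodMk continuous_const)
  rw [integral_eq_sub_of_hasDerivAt
    (fun ρ _ => hasDerivAt_inner_planePolar_radius (hv.differentiable one_ne_zero) c e₁ e₂ ρ θ)
    (hc.intervalIntegrable _ _)]
  simp

/-- Fubini on a rectangle for a jointly continuous integrand, interval-integral form, any order
of the outer limits. [folklore] -/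
theorem intervalIntegral_swap_of_continuous_uncurry {f : ℝ → ℝ → ℝ}
    (hf : Continuous fun q : ℝ × ℝ => f q.1 q.2) (a b : ℝ) {c d : ℝ} (hcd : c ≤ d) :
    ∫ x in a..b, ∫ y in c..d, f x y = ∫ y in c..d, ∫ x in a..b, f x y := by
  have key : ∀ a b : ℝ, a ≤ b →
      ∫ x in a..b, ∫ y in c..d, f x y = ∫ y in c..d, ∫ x in a..b, f x y := by
    intro a b hab
    simp_rw [intervalIntegral.integral_of_le hab, intervalIntegral.integral_of_le hcd]
    refine MeasureTheory.integral_integral_swap ?_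
    rw [Measure.prod_restrict, ← Measure.volume_eq_prod]
    exact (hf.continuousOn.integrableOn_compact (isCompact_Icc.prod isCompact_Icc)).mono_set
      (Set.prod_mono Ioc_subset_Icc_self Ioc_subset_Icc_self)
  rcases le_total a b with hab | hba
  · exact key a b hab
  · have h1 : ∫ x in a..b, ∫ y in c..d, f x y = -∫ x in b..a, ∫ y in c..d, f x y :=
      intervalIntegral.integral_symm b a
    have h2 : ∀ y, ∫ x in a..b, f x y = -∫ x in b..a, f x y := fun y =>
      intervalIntegral.integral_symm b a
    rw [h1, key b a hba]
    simp_rw [h2, intervalIntegral.integral_neg]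

/-- **Stokes' theorem for planar discs (Green's formula in polar coordinates).** For a `C¹`
vector field `v` on a real inner product space, any centre `c`, frame `(e₁, e₂)` and `R : ℝ`,
the circulation around the planar circle `circleLoop c R e₁ e₂` equals
`∫₀^R ∫₀^{2π} ρ (⟪Dv(x) e₁, e₂⟫ − ⟪Dv(x) e₂, e₁⟫) dθ dρ`, `x = c + (ρ cos θ) e₁ + (ρ sin θ) e₂` —
the flux through the disc, in polar coordinates, of the antisymmetric part of the Jacobian in
the plane of the frame (on `ℝ³` with `(e₁, e₂)` orthonormal this is the normal vorticity,
`circulation_circleLoop_eq_integral_curl`). (Majda–Bertozzi, §1.6; Saffman, §1.4.) [folklore] -/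
theorem circulation_circleLoop_eq_integral_fderiv (hv : ContDiff ℝ 1 v) (c e₁ e₂ : E) (R : ℝ) :
    circulation v (circleLoop c R e₁ e₂) =
      ∫ ρ in (0 : ℝ)..R, ∫ θ in (0 : ℝ)..2 * π,
        ρ * (⟪fderiv ℝ v (c + (ρ * cos θ) • e₁ + (ρ * sin θ) • e₂) e₁, e₂⟫
          - ⟪fderiv ℝ v (c + (ρ * cos θ) • e₁ + (ρ * sin θ) • e₂) e₂, e₁⟫) := by
  -- pointwise: `ρ A(x) = ∂_ρ F − ∂_θ G`
  have hkey : ∀ ρ θ : ℝ,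
      ρ * (⟪fderiv ℝ v (planePolar c e₁ e₂ ρ θ) e₁, e₂⟫
        - ⟪fderiv ℝ v (planePolar c e₁ e₂ ρ θ) e₂, e₁⟫) =
      (⟪v (planePolar c e₁ e₂ ρ θ), (-(sin θ)) • e₁ + (cos θ) • e₂⟫
        + ⟪fderiv ℝ v (planePolar c e₁ e₂ ρ θ) ((cos θ) • e₁ + (sin θ) • e₂),
            (-(ρ * sin θ)) • e₁ + (ρ * cos θ) • e₂⟫)
      - (⟪v (planePolar c e₁ e₂ ρ θ), (-(sin θ)) • e₁ + (cos θ) • e₂⟫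
        + ⟪fderiv ℝ v (planePolar c e₁ e₂ ρ θ) ((-(ρ * sin θ)) • e₁ + (ρ * cos θ) • e₂),
            (cos θ) • e₁ + (sin θ) • e₂⟫) := by
    intro ρ θ
    rw [← inner_apply_polar_frame_sub]
    ring
  have h2π : (0 : ℝ) ≤ 2 * π := by positivity
  symm
  calc ∫ ρ in (0 : ℝ)..R, ∫ θ in (0 : ℝ)..2 * π,
        ρ * (⟪fderiv ℝ v (planePolar c e₁ e₂ ρ θ) e₁, e₂⟫
          - ⟪fderiv ℝ v (planePolar c e₁ e₂ ρ θ) e₂, e₁⟫)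
      = ∫ ρ in (0 : ℝ)..R, ∫ θ in (0 : ℝ)..2 * π,
          (⟪v (planePolar c e₁ e₂ ρ θ), (-(sin θ)) • e₁ + (cos θ) • e₂⟫
            + ⟪fderiv ℝ v (planePolar c e₁ e₂ ρ θ) ((cos θ) • e₁ + (sin θ) • e₂),
                (-(ρ * sin θ)) • e₁ + (ρ * cos θ) • e₂⟫) := by
        refine integral_congr fun ρ _ => ?_
        have hi₁ : IntervalIntegrable (fun θ : ℝ =>
            ⟪v (planePolar c e₁ e₂ ρ θ), (-(sin θ)) • e₁ + (cos θ) • e₂⟫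
              + ⟪fderiv ℝ v (planePolar c e₁ e₂ ρ θ) ((cos θ) • e₁ + (sin θ) • e₂),
                  (-(ρ * sin θ)) • e₁ + (ρ * cos θ) • e₂⟫) volume 0 (2 * π) :=
          ((continuous_inner_planePolar_radius_deriv hv c e₁ e₂).comp
            (continuous_const.prodMk continuous_id)).intervalIntegrable _ _
        have hi₂ := (continuous_inner_planePolar_angle_deriv hv c e₁ e₂ ρ).intervalIntegrable
          (μ := volume) 0 (2 * π)
        rw [integral_congr fun θ _ => hkey ρ θ, intervalIntegral.integral_sub hi₁ hi₂,
          integral_inner_planePolar_angle_deriv_eq_zero hv c e₁ e₂ ρ, sub_zero]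
    _ = ∫ θ in (0 : ℝ)..2 * π, ∫ ρ in (0 : ℝ)..R,
          (⟪v (planePolar c e₁ e₂ ρ θ), (-(sin θ)) • e₁ + (cos θ) • e₂⟫
            + ⟪fderiv ℝ v (planePolar c e₁ e₂ ρ θ) ((cos θ) • e₁ + (sin θ) • e₂),
                (-(ρ * sin θ)) • e₁ + (ρ * cos θ) • e₂⟫) := by
        refine intervalIntegral_swap_of_continuous_uncurry ?_ 0 R h2π
        exact continuous_inner_planePolar_radius_deriv hv c e₁ e₂
    _ = ∫ θ in (0 : ℝ)..2 * π,
          ⟪v (planePolar c e₁ e₂ R θ), (-(R * sin θ)) • e₁ + (R * cos θ) • e₂⟫ :=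
        integral_congr fun θ _ => integral_inner_planePolar_radius_deriv hv c e₁ e₂ θ R
    _ = circulation v (circleLoop c R e₁ e₂) := (circulation_circleLoop v c R e₁ e₂).symm

end Disc

/-! ### Three dimensions: the disc flux of the vorticity -/

section R3

/-- **The vorticity pairs with `a × b` as the antisymmetric part of the Jacobian**:
`⟪curl v (x), a × b⟫ = ⟪Dv(x) a, b⟫ − ⟪Dv(x) b, a⟫` for all `a, b ∈ ℝ³`
(Majda–Bertozzi, §1.2, eq. (1.24): `½ ω × h = Ω h`, `Ω = ½(∇v − ∇vᵀ)`). Coordinate computation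
from the definitions of `curl` and `cross`; no differentiability hypothesis (both sides use the
same `fderiv`). [folklore] -/
theorem inner_curl_cross (v : EuclideanSpace ℝ (Fin 3) → EuclideanSpace ℝ (Fin 3))
    (x a b : EuclideanSpace ℝ (Fin 3)) :
    ⟪curl v x, cross a b⟫ = ⟪fderiv ℝ v x a, b⟫ - ⟪fderiv ℝ v x b, a⟫ := by
  set D := fderiv ℝ v x with hD
  have hlin : ∀ w : EuclideanSpace ℝ (Fin 3), D w = ∑ j, w j • D (EuclideanSpace.single j 1) :=
      fun w => by
    conv_lhs => rw [show w = ∑ j, w j • EuclideanSpace.single j (1 : ℝ) by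
      simpa using ((EuclideanSpace.basisFun (Fin 3) ℝ).sum_repr w).symm]
    simp [map_sum, map_smul]
  rw [hlin a, hlin b]
  simp only [Fin.sum_univ_three, PiLp.inner_apply, RCLike.inner_apply, conj_trivial,
    PiLp.add_apply, PiLp.smul_apply, smul_eq_mul]
  simp [curl, cross, cross_apply, hD]
  ring

/-- **Stokes' theorem for planar discs in `ℝ³`.** For a `C¹` field `v` on `ℝ³`, the circulation
around the planar circle `circleLoop c R e₁ e₂` is the polar-coordinate flux of the vorticity
through the disc: `∮ v · dℓ = ∫₀^R ∫₀^{2π} ρ ⟪curl v (x), e₁ × e₂⟫ dθ dρ`,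
`x = c + (ρ cos θ) e₁ + (ρ sin θ) e₂`; for an orthonormal frame, `e₁ × e₂` is the unit normal
of the disc and `ρ dθ dρ` its area element (Majda–Bertozzi, §1.6, (1.60)–(1.61); Saffman, §1.4). [folklore] -/
theorem circulation_circleLoop_eq_integral_curl
    {v : EuclideanSpace ℝ (Fin 3) → EuclideanSpace ℝ (Fin 3)} (hv : ContDiff ℝ 1 v)
    (c e₁ e₂ : EuclideanSpace ℝ (Fin 3)) (R : ℝ) :
    circulation v (circleLoop c R e₁ e₂) =
      ∫ ρ in (0 : ℝ)..R, ∫ θ in (0 : ℝ)..2 * π,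
        ρ * ⟪curl v (c + (ρ * cos θ) • e₁ + (ρ * sin θ) • e₂), cross e₁ e₂⟫ := by
  rw [circulation_circleLoop_eq_integral_fderiv hv]
  simp_rw [inner_curl_cross]

end R3

end Literature.Analysis.FluidPDE
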